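import Mathlib
import HarnessLib

/-!
# Support functions of convex bodies: the elementary calculus

Topic `Literature/Analysis/Convexity`; namespace `Literature.Analysis.Convexity`.

The support function `h(K, ν) = sup {⟪y, ν⟫ : y ∈ K}` of a set `K` in a real inner product space,
written as in the crystal routes (`supportFn K ν := sSup ((fun y => ⟪y, ν⟫) '' K)`) — we do not
introduce a definition, every statement is about `sSup ((fun y => ⟪y, ν⟫) '' K)`.  The elementary
rules of Schneider's §1.7: translation `h(K + t, ν) = h(K, ν) + ⟪t, ν⟫`, dilation
`h(rK, ·) = r h(K, ·)` (`r ≥ 0`), reflection `h(−K, ν) = h(K, −ν)`, monotonicity in `K`, behaviour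
under linear isometries `h(gK, ν) = h(K, g⁻¹ν)` (rotated Wulff bodies), the bound `h(K, ν) ≤ R‖ν‖`
for `K ⊆ B̄(0, R)`, and two evaluations used by the crystal routes: the ball `h(B̄(0,r), ν) = r‖ν‖`
and the unit disc orthogonal to a unit vector `m` (the "wall body"),
`h({‖y‖ ≤ 1, ⟪y, m⟫ = 0}, ν) = ‖ν − ⟪ν, m⟫ m‖`.
(Nonnegativity for `0 ∈ K` and attainment on compact `K` are `sSup_inner_nonneg`,
`exists_mem_inner_eq_sSup` of `AnisotropicPerimeterPatches.lean`.)
[cite: Schneider1993, Section 1.7 (properties of h(K, ·) following its definition)]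
-/

noncomputable section

namespace Literature.Analysis.Convexity

open Set Metric
open scoped RealInnerProductSpace Pointwise

variable {V : Type*} [NormedAddCommGroup V] [InnerProductSpace ℝ V]

/-- The image `{⟪y, ν⟫ : y ∈ K}` of a bounded set is bounded above (by `R‖ν‖` if `K ⊆ B̄(0,R)`).
[cite: Schneider1993, Section 1.7 — plumbing] -/
theorem bddAbove_inner_image_of_isBounded {K : Set V} (hK : Bornology.IsBounded K) (ν : V) :
    BddAbove ((fun y : V => ⟪y, ν⟫) '' K) := by
  obtain ⟨R, hR⟩ := hK.subset_closedBall 0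
  refine ⟨R * ‖ν‖, ?_⟩
  rintro _ ⟨y, hy, rfl⟩
  have hyR : ‖y‖ ≤ R := by simpa using hR hy
  show ⟪y, ν⟫ ≤ R * ‖ν‖
  exact (real_inner_le_norm y ν).trans (mul_le_mul_of_nonneg_right hyR (norm_nonneg _))

/-- **Bound by the circumradius**: `K ⊆ B̄(0, R)`, `K ≠ ∅` ⇒ `h(K, ν) ≤ R‖ν‖`.
[cite: Schneider1993, Section 1.7] -/
theorem sSup_inner_image_le_of_subset_closedBall {K : Set V} {R : ℝ} (hK : K ⊆ closedBall 0 R)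
    (hne : K.Nonempty) (ν : V) : sSup ((fun y : V => ⟪y, ν⟫) '' K) ≤ R * ‖ν‖ := by
  refine csSup_le (hne.image _) ?_
  rintro _ ⟨y, hy, rfl⟩
  have hyR : ‖y‖ ≤ R := by simpa using hK hy
  show ⟪y, ν⟫ ≤ R * ‖ν‖
  exact (real_inner_le_norm y ν).trans (mul_le_mul_of_nonneg_right hyR (norm_nonneg _))

/-- **Monotonicity**: `K ⊆ L` (with `L` bounded, `K ≠ ∅`) ⇒ `h(K, ν) ≤ h(L, ν)`.
[cite: Schneider1993, Section 1.7 (h_K ≤ h_L iff K ⊆ L)] -/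
theorem sSup_inner_image_mono {K L : Set V} (hKL : K ⊆ L) (hL : Bornology.IsBounded L)
    (hne : K.Nonempty) (ν : V) :
    sSup ((fun y : V => ⟪y, ν⟫) '' K) ≤ sSup ((fun y : V => ⟪y, ν⟫) '' L) :=
  csSup_le_csSup (bddAbove_inner_image_of_isBounded hL ν) (hne.image _) (image_mono hKL)

/-- **Translation**: `h(t + K, ν) = ⟪t, ν⟫ + h(K, ν)` (`K` bounded and nonempty).
[cite: Schneider1993, Section 1.7 (h(K + t, u) = h(K, u) + ⟨t, u⟩)] -/
theorem sSup_inner_image_vadd {K : Set V} (hK : Bornology.IsBounded K) (hne : K.Nonempty)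
    (t ν : V) :
    sSup ((fun y : V => ⟪y, ν⟫) '' (t +ᵥ K)) = ⟪t, ν⟫ + sSup ((fun y : V => ⟪y, ν⟫) '' K) := by
  have himg : (fun y : V => ⟪y, ν⟫) '' (t +ᵥ K) =
      (fun r => ⟪t, ν⟫ + r) '' ((fun y : V => ⟪y, ν⟫) '' K) := by
    rw [Set.image_image, ← Set.image_vadd, Set.image_image]
    refine Set.image_congr fun y _ => ?_
    simp [inner_add_left]
  rw [himg]
  have hmono : Monotone fun r : ℝ => ⟪t, ν⟫ + r := fun a b h => by dsimp only; linarith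
  exact (hmono.map_csSup_of_continuousAt (continuous_const.add continuous_id).continuousAt
    (hne.image _) (bddAbove_inner_image_of_isBounded hK ν)).symm

/-- **Dilation**: `h(rK, ν) = r · h(K, ν)` for `r ≥ 0` (`K` bounded and nonempty).
[cite: Schneider1993, Section 1.7 (h(λK, ·) = λ h(K, ·))] -/
theorem sSup_inner_image_smul {K : Set V} (hK : Bornology.IsBounded K) (hne : K.Nonempty)
    {r : ℝ} (hr : 0 ≤ r) (ν : V) :
    sSup ((fun y : V => ⟪y, ν⟫) '' (r • K)) = r * sSup ((fun y : V => ⟪y, ν⟫) '' K) := by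
  have himg : (fun y : V => ⟪y, ν⟫) '' (r • K) =
      (fun s => r * s) '' ((fun y : V => ⟪y, ν⟫) '' K) := by
    rw [Set.image_image, ← Set.image_smul, Set.image_image]
    refine Set.image_congr fun y _ => ?_
    simp [real_inner_smul_left]
  rw [himg]
  have hmono : Monotone fun s : ℝ => r * s := fun a b h => mul_le_mul_of_nonneg_left h hr
  exact (hmono.map_csSup_of_continuousAt (continuous_const.mul continuous_id).continuousAt
    (hne.image _) (bddAbove_inner_image_of_isBounded hK ν)).symm

/-- **Reflection**: `h(−K, ν) = h(K, −ν)` (no hypotheses: the two value sets coincide).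
[cite: Schneider1993, Section 1.7 (h(−K, u) = h(K, −u))] -/
theorem sSup_inner_image_neg (K : Set V) (ν : V) :
    sSup ((fun y : V => ⟪y, ν⟫) '' (-K)) = sSup ((fun y : V => ⟪y, -ν⟫) '' K) := by
  congr 1
  ext r
  simp only [Set.mem_image, Set.mem_neg]
  constructor
  · rintro ⟨y, hy, rfl⟩; exact ⟨-y, hy, by simp [inner_neg_left, inner_neg_right]⟩
  · rintro ⟨y, hy, rfl⟩; exact ⟨-y, by simpa using hy, by simp [inner_neg_left, inner_neg_right]⟩

/-- **Linear isometries**: `h(g K, ν) = h(K, g⁻¹ ν)` for a linear isometric equivalence `g`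
(the support function of a rotated Wulff body `A W` is `h_W ∘ A⁻¹`).
[cite: Schneider1993, Section 1.7] -/
theorem sSup_inner_image_image_linearIsometryEquiv (g : V ≃ₗᵢ[ℝ] V) (K : Set V) (ν : V) :
    sSup ((fun y : V => ⟪y, ν⟫) '' (g '' K)) = sSup ((fun y : V => ⟪y, g.symm ν⟫) '' K) := by
  rw [Set.image_image]
  congr 1
  refine Set.image_congr fun y _ => ?_
  conv_lhs => rw [← g.apply_symm_apply ν]
  exact g.inner_map_map y (g.symm ν)

/-- **The ball**: `h(B̄(0, r), ν) = r‖ν‖` for `r ≥ 0`.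
[cite: Schneider1993, Section 1.7] -/
theorem sSup_inner_image_closedBall {r : ℝ} (hr : 0 ≤ r) (ν : V) :
    sSup ((fun y : V => ⟪y, ν⟫) '' closedBall (0 : V) r) = r * ‖ν‖ := by
  apply le_antisymm
  · exact sSup_inner_image_le_of_subset_closedBall subset_rfl ⟨0, by simp [hr]⟩ ν
  · by_cases hν : ν = 0
    · subst hν
      have h0 : (0 : ℝ) ∈ (fun y : V => ⟪y, (0 : V)⟫) '' closedBall (0 : V) r :=
        ⟨0, by simp [hr], by simp⟩
      have h := le_csSup (bddAbove_inner_image_of_isBounded isBounded_closedBall (0 : V)) h0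
      simpa using h
    · refine le_csSup (bddAbove_inner_image_of_isBounded isBounded_closedBall ν)
        ⟨(r / ‖ν‖) • ν, ?_, ?_⟩
      · simp [norm_smul, abs_of_nonneg hr, div_mul_cancel₀ r (norm_ne_zero_iff.2 hν)]
      · show ⟪(r / ‖ν‖) • ν, ν⟫ = r * ‖ν‖
        rw [real_inner_smul_left, real_inner_self_eq_norm_sq]
        field_simp

/-- **The wall disc**: for a unit vector `m`, the unit disc orthogonal to `m`,
`D(m) = {y | ‖y‖ ≤ 1, ⟪y, m⟫ = 0}`, has support function `h(D(m), ν) = ‖ν − ⟪ν, m⟫ m‖`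
(the norm of the component of `ν` orthogonal to `m`).
[cite: Schneider1993, Section 1.7 (h(K|E, u) = h(K, u) for u ∈ E, with the ball)] -/
theorem sSup_inner_image_disc {m : V} (hm : ‖m‖ = 1) (ν : V) :
    sSup ((fun y : V => ⟪y, ν⟫) '' {y : V | ‖y‖ ≤ 1 ∧ ⟪y, m⟫ = 0}) = ‖ν - ⟪ν, m⟫ • m‖ := by
  set p : V := ν - ⟪ν, m⟫ • m with hp
  have hmm : ⟪m, m⟫ = 1 := by rw [real_inner_self_eq_norm_sq, hm, one_pow]
  have hpm : ⟪p, m⟫ = 0 := by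
    rw [hp, inner_sub_left, real_inner_smul_left, hmm, mul_one, sub_self]
  -- on the disc, `⟪y, ν⟫ = ⟪y, p⟫ ≤ ‖y‖ ‖p‖ ≤ ‖p‖`
  have hval : ∀ y : V, ⟪y, m⟫ = 0 → ⟪y, ν⟫ = ⟪y, p⟫ := by
    intro y hy
    rw [hp, inner_sub_right, real_inner_smul_right, hy, mul_zero, sub_zero]
  have hbdd : Bornology.IsBounded {y : V | ‖y‖ ≤ 1 ∧ ⟪y, m⟫ = 0} :=
    (isBounded_closedBall (x := (0 : V)) (r := 1)).subset fun y hy => by simpa using hy.1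
  have hne : ({y : V | ‖y‖ ≤ 1 ∧ ⟪y, m⟫ = 0}).Nonempty := ⟨0, by simp⟩
  apply le_antisymm
  · refine csSup_le (hne.image _) ?_
    rintro _ ⟨y, ⟨hy1, hym⟩, rfl⟩
    show ⟪y, ν⟫ ≤ ‖p‖
    rw [hval y hym]
    exact (real_inner_le_norm y p).trans (mul_le_of_le_one_left (norm_nonneg _) hy1)
  · by_cases hp0 : p = 0
    · rw [hp0, norm_zero]
      exact le_csSup (bddAbove_inner_image_of_isBounded hbdd ν) ⟨0, by simp, by simp⟩
    · refine le_csSup (bddAbove_inner_image_of_isBounded hbdd ν) ⟨‖p‖⁻¹ • p, ⟨?_, ?_⟩, ?_⟩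
      · simp [norm_smul, inv_mul_cancel₀ (norm_ne_zero_iff.2 hp0)]
      · rw [real_inner_smul_left, hpm, mul_zero]
      · have h := hval (‖p‖⁻¹ • p) (by rw [real_inner_smul_left, hpm, mul_zero])
        simp only at h ⊢
        rw [h, real_inner_smul_left, real_inner_self_eq_norm_sq]
        field_simp

/-! ### Polar bodies of rotated support functions (`{y | ∀ ν, ⟪y, ν⟫ ≤ h ν}` under a linear isometry) -/

/-- **A linear isometry `g` maps the body `{y | ⟪y, ν⟫ ≤ h(ν) ∀ν}` onto the body of the rotated function
`ν ↦ h(g⁻¹ ν)`** (e.g. the Wulff body of the surface tension of a rotated lattice is the rotated Wulff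
body; no homogeneity or convexity of `h` is needed). [cite: Schneider1993, Section 1.7 (support
functions under rigid motions)] -/
theorem image_linearIsometryEquiv_setOf_forall_inner_le (g : V ≃ₗᵢ[ℝ] V) (h : V → ℝ) :
    g '' {y : V | ∀ ν : V, ⟪y, ν⟫ ≤ h ν} = {y : V | ∀ ν : V, ⟪y, ν⟫ ≤ h (g.symm ν)} := by
  ext y
  simp only [Set.mem_image, Set.mem_setOf_eq]
  constructor
  · rintro ⟨x, hx, rfl⟩ ν
    have e : ⟪g x, ν⟫ = ⟪x, g.symm ν⟫ := by
      conv_lhs => rw [← g.apply_symm_apply ν]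
      exact g.inner_map_map x (g.symm ν)
    rw [e]
    exact hx _
  · intro hy
    refine ⟨g.symm y, fun ν => ?_, g.apply_symm_apply y⟩
    have e : ⟪g.symm y, ν⟫ = ⟪y, g ν⟫ := by
      conv_rhs => rw [← g.apply_symm_apply y]
      exact (g.inner_map_map (g.symm y) ν).symm
    rw [e]
    simpa using hy (g ν)

/-- The same with the unit-sphere constraint (Wulff SETS `{y | ⟪y, ν⟫ ≤ h(ν) ∀ ‖ν‖ = 1}`): a linear
isometry maps the Wulff set of `h` onto the Wulff set of `h ∘ g⁻¹`.
[cite: Schneider1993, Section 1.7] -/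
theorem image_linearIsometryEquiv_setOf_forall_norm_eq_one_inner_le (g : V ≃ₗᵢ[ℝ] V) (h : V → ℝ) :
    g '' {y : V | ∀ ν : V, ‖ν‖ = 1 → ⟪y, ν⟫ ≤ h ν} =
      {y : V | ∀ ν : V, ‖ν‖ = 1 → ⟪y, ν⟫ ≤ h (g.symm ν)} := by
  ext y
  simp only [Set.mem_image, Set.mem_setOf_eq]
  constructor
  · rintro ⟨x, hx, rfl⟩ ν hν
    have e : ⟪g x, ν⟫ = ⟪x, g.symm ν⟫ := by
      conv_lhs => rw [← g.apply_symm_apply ν]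
      exact g.inner_map_map x (g.symm ν)
    rw [e]
    exact hx _ (by simpa using hν)
  · intro hy
    refine ⟨g.symm y, fun ν hν => ?_, g.apply_symm_apply y⟩
    have e : ⟪g.symm y, ν⟫ = ⟪y, g ν⟫ := by
      conv_rhs => rw [← g.apply_symm_apply y]
      exact (g.inner_map_map (g.symm y) ν).symm
    rw [e]
    simpa using hy (g ν) (by simpa using hν)

/-- The support function of the rotated body is the rotated support function:
`h(g '' {⟪·,ν⟫ ≤ f}, ν) = h({⟪·,ν⟫ ≤ f}, g⁻¹ ν)` (special case of
`sSup_inner_image_image_linearIsometryEquiv`, recorded in the polar-body spelling).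
[cite: Schneider1993, Section 1.7] -/
theorem sSup_inner_image_setOf_forall_inner_le_rotated (g : V ≃ₗᵢ[ℝ] V) (h : V → ℝ) (ν : V) :
    sSup ((fun y : V => ⟪y, ν⟫) '' {y : V | ∀ μ : V, ⟪y, μ⟫ ≤ h (g.symm μ)}) =
      sSup ((fun y : V => ⟪y, g.symm ν⟫) '' {y : V | ∀ μ : V, ⟪y, μ⟫ ≤ h μ}) := by
  rw [← image_linearIsometryEquiv_setOf_forall_inner_le, sSup_inner_image_image_linearIsometryEquiv]

end Literature.Analysis.Convexity

end
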